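import Summits.BirchSwinnertonDyer.BirchSwinnertonDyer.Theorems.PrintCf2SplitBadTwoLocSurjWstar
import Summits.BirchSwinnertonDyer.BirchSwinnertonDyer.Theorems.PrintCf2SplitBadTwoRestrictedSelmerKummerInRestricted
import Summits.BirchSwinnertonDyer.BirchSwinnertonDyer.Theorems.PrintCf2SplitBadTwoRestrictedSelmerPairBase
import Summits.BirchSwinnertonDyer.Rank1Residual.X11b.AnticyclotomicLevelStructure
import Summits.BirchSwinnertonDyer.Rank1Residual.X11b.AnticyclotomicControlMap
import HarnessLib

/-!
# Crux `PrintCf2.SplitBadTwoRankOneOfFacts` (stmt-BirchSwinnertonDyer-20368), road α v10.3, S3c residual (F3), piece (P1) — the LEVEL LIFT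
# `[H¹_𝓖(K, E[p^N]) : H¹_𝓕(K, E[p^N])] = #loc_v(𝔖_v̄(K, W*))` for the e-relaxed torsion structures (OPTION A‴)

Cell `bsd-print-cf2`, EXTRA WIDTH seat `bsd-line-cf2-p1-w5` g3; `--supports stmt-BirchSwinnertonDyer-20368` (helper, Theses-free). HONEST FRAMING:
nothing here closes the crux or a registered stub; BSD is not proved by any of this; no summit statement is proved by this seat. No definition,
no named fact, no `sorry`, no kit. beyond-print theorem: no.
WHAT. `V` elliptic over a totally complex `K`, `p` prime, `W* = V.endEigenPrimaryTorsion p π r`, an equivariant projector `e` (`e ∘ ι = id`) with a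
level-`N` shadow `eN` (`ι_N ∘ eN = ι ∘ e ∘ ι_N`, p669287); LEVEL-LIFT MAP `Φ = res_{Γ_K → ⊤} ∘ H¹(e) ∘ H¹(ι_N) : H¹(K, E[p^N]) → H¹(⊤, W*)`.
`resOfLe_levelLift_eq_zero_iff` (`res_{D_w}(Φ x) = 0 ↔ loc_w x ∈ L_w`, the e-RELAXED propagated zero condition), `levelLift_mem_restrictedSelmerBase` +
`exists_levelLift_eq_of_mem_restrictedSelmerBase` (`Φ(H¹_𝓖) = 𝔖_v̄(K, W*)` for `𝓖 = 𝓕[v ↦ ⊤]` once `p^N` kills `𝔖_v̄`), and the (P1)-LIFT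
**`relIndex_selmerGroup_update_top_eq_natCard_range_resOfLe`**: `𝓕.selmerGroup.relIndex 𝓖.selmerGroup = Nat.card (range (res_{D_v} ∘ 𝔖_v̄.subtype))`
— the index of p675947 `relIndex_selmerGroup_update_top_mul_eq_sq` equals the quantity of p674907 `card_restrictedSelmerBase_eq_card_inf_mul_card_range_resOfLe`
(first isomorphism theorem for `res_{D_v} ∘ Φ` on `H¹_𝓖`). presearch: level lift `E[p^N] → E[p^∞]` on Selmer groups → [corpus: GreenbergLNM1716 §5
proof of Prop. 5.8; JetchevSkinnerWan2017 §3.3]; no new fact.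
References: [GreenbergLNM1716] §2 p. 63, §5; [JetchevSkinnerWan2017] §3.3; [MazurRubin2004] Def. 2.1.1; [SerreGaloisCohomology1997] I §2.4; [Agboola2007] §3, §6.
-/

noncomputable section

open scoped Classical

set_option linter.dupNamespace false
set_option autoImplicit false

open CategoryTheory Function Field NumberField IsDedekindDomain
open Literature.NumberTheory.EllipticCurves Literature.NumberTheory.EllipticCurves.GreenbergSelmer
open Literature.NumberTheory.EllipticCurves.Agboola2007
open Literature.NumberTheory.GaloisRepresentations
open Literature.NumberTheory.GaloisRepresentations.DiscreteGaloisModule (SelmerStructure)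
open Literature.NumberTheory.GaloisCohomology
open scoped ContRepresentation
open Summit.BirchSwinnertonDyer.Rank1Residual.X11b
open Summit.BirchSwinnertonDyer.Rank1Residual.X11b.LocBridge
open Summit.BirchSwinnertonDyer.Rank1Residual.X11b.Levels
open Summit.BirchSwinnertonDyer.Rank1Residual.X11b.AcSelmer
open Summit.BirchSwinnertonDyer.Rank1Residual.X11b.Coinv
open Summit.BirchSwinnertonDyer.BirchSwinnertonDyer.Theorems.PrintCf2
open Summit.BirchSwinnertonDyer.BirchSwinnertonDyer.Theorems.PrintCf2.LevelEigen

universe u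

namespace Summit.BirchSwinnertonDyer.BirchSwinnertonDyer.Theorems.PrintCf2.RestrictedSelmerPair

section Transport

variable {K : Type u} [Field K] (M : Type u) [AddCommGroup M] [DistribMulAction (absoluteGaloisGroup K) M]
  [TopologicalSpace M] [DiscreteTopology M]

/-- **`res_{⊤ ⊓ D}(res_{Γ_K → ⊤} g) = 0 ↔ res_D g = 0`**: `res_{⊤ → ⊤ ⊓ D} ∘ res_{Γ_K → ⊤} = res_{D → ⊤ ⊓ D} ∘ res_D` and `res_{D → ⊤ ⊓ D}` is
injective (`⊤ ⊓ D = D`). [cite: SerreGaloisCohomology1997, I §2.4] -/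
theorem resOfLe_inf_resH1Hom_subgroupIncl_eq_zero_iff (D : Subgroup (absoluteGaloisGroup K))
    (g : discreteH1 (absoluteGaloisGroup K) M) :
    resOfLe M (inf_le_left : (⊤ : Subgroup (absoluteGaloisGroup K)) ⊓ D ≤ ⊤)
        (resH1Hom (Literature.NumberTheory.EllipticCurves.subgroupIncl (⊤ : Subgroup (absoluteGaloisGroup K))) (AddMonoidHom.id M)
          (fun _ _ ↦ rfl) g) = 0 ↔
      ResKernel.resSubgroup D M g = 0 := by
  have h1 := congrArg (fun F ↦ F g)
    (Summit.BirchSwinnertonDyer.Rank1Residual.X11b.AcSelmer.resOfLe_top_comp_resH1Hom_subgroupIncl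
      (H := (⊤ : Subgroup (absoluteGaloisGroup K)) ⊓ D) (M := M))
  have h2 : (resOfLe M (inf_le_right : (⊤ : Subgroup (absoluteGaloisGroup K)) ⊓ D ≤ D)).comp (ResKernel.resSubgroup D M) =
      ResKernel.resSubgroup ((⊤ : Subgroup (absoluteGaloisGroup K)) ⊓ D) M := by
    rw [resOfLe, ResKernel.resSubgroup, ResKernel.resSubgroup, resH1Hom_comp]
    exact resH1Hom_congr (by ext; rfl) (by ext; rfl) _ _
  have h2' := congrArg (fun F ↦ F g) h2
  simp only [AddMonoidHom.coe_comp, Function.comp_apply] at h1 h2'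
  rw [h1, ← h2', ← (resOfLe_injective_of_ge M (inf_le_right : (⊤ : Subgroup (absoluteGaloisGroup K)) ⊓ D ≤ D)
    (le_inf le_top le_rfl)).eq_iff, map_zero]

end Transport

section LevelLift

variable {K : Type} [Field K] [NumberField K] (V : WeierstrassCurve K) [V.IsElliptic] (p : ℕ) [Fact p.Prime]
  (π : V.endRing) (r : ℤ_[p]) (N : ℕ)
  (e : V.geomPrimaryTorsion p →+ ↥(V.endEigenPrimaryTorsion p π r))
  (he : ∀ (σ : absoluteGaloisGroup K) (x : V.geomPrimaryTorsion p), e (σ • x) = σ • e x)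

omit [NumberField K] [V.IsElliptic] in
/-- **`H¹(e)` commutes with restriction to `D_w`**: `res_{D_w}(H¹(e) g) = H¹(e|_{D_w})(res_{D_w} g)`. [cite: SerreGaloisCohomology1997, I §2.4] -/
theorem resSubgroup_resH1Hom_proj (D : Subgroup (absoluteGaloisGroup K)) (g : discreteH1 (absoluteGaloisGroup K) (V.geomPrimaryTorsion p)) :
    ResKernel.resSubgroup D ↥(V.endEigenPrimaryTorsion p π r) (resH1Hom (ContinuousMonoidHom.id (absoluteGaloisGroup K)) e (fun σ m ↦ he σ m) g) =
      resH1Hom (ContinuousMonoidHom.id D) e (fun σ m ↦ he σ m) (ResKernel.resSubgroup D (V.geomPrimaryTorsion p) g) := by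
  have hnat := congrArg (fun f ↦ f g) (ResKernel.resH1Hom_comp_resSubgroup (ContinuousMonoidHom.id (absoluteGaloisGroup K)) e
    (fun σ m ↦ he σ m) D D (ContinuousMonoidHom.id _) (fun _ ↦ rfl) (fun σ m ↦ he σ m))
  simp only [AddMonoidHom.comp_apply] at hnat
  exact hnat.symm

omit [V.IsElliptic] in
/-- **Vanishing transport**: if `loc_w x ∈ ker(H¹(K_w, E[p^N]) → H¹(K_w, E[p^∞]))` then the level lift `Φ x = res_{Γ_K → ⊤}(H¹(e)(H¹(ι_N) x))`
dies on `D_w`. [cite: GreenbergLNM1716, §5 proof of Prop. 5.8] [cite: SerreGaloisCohomology1997, I §2.4] -/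
theorem resOfLe_levelLift_eq_zero_of_map_eq_zero (w : HeightOneSpectrum (𝓞 K))
    (x : galoisCohomology (V.torsionGaloisModule ((p ^ N : ℕ) : ℤ)) 1)
    (hx : galoisCohomology.map ((primaryInclusion V p N).restrictField (w.adicCompletion K)) 1
      (galoisCohomology.localization (V.torsionGaloisModule ((p ^ N : ℕ) : ℤ)) (Sum.inr w : Place K) 1 x) = 0) :
    resOfLe ↥(V.endEigenPrimaryTorsion p π r) (inf_le_left : (⊤ : Subgroup (absoluteGaloisGroup K)) ⊓ decomp w ≤ ⊤)
        (resH1Hom (Literature.NumberTheory.EllipticCurves.subgroupIncl (⊤ : Subgroup (absoluteGaloisGroup K)))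
          (AddMonoidHom.id ↥(V.endEigenPrimaryTorsion p π r)) (fun _ _ ↦ rfl)
          (resH1Hom (ContinuousMonoidHom.id (absoluteGaloisGroup K)) e (fun σ m ↦ he σ m)
            (toDiscreteH1 (isOpen_stabilizer_geomPrimaryTorsion V p) (galoisCohomology.map (primaryInclusion V p N) 1 x)))) = 0 := by
  set G := galoisCohomology.map (primaryInclusion V p N) 1 x with hG
  have h0 : galoisCohomology.localization (primaryGaloisModule V p) (Sum.inr w : Place K) 1 G = 0 := by
    have h := localization_map_one (primaryInclusion V p N) (Sum.inr w : Place K) x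
    rw [← hG] at h
    rw [h]
    exact hx
  have hres : ResKernel.resSubgroup (decomp (K := K) w) (V.geomPrimaryTorsion p) (toDiscreteH1 (isOpen_stabilizer_geomPrimaryTorsion V p) G) = 0 :=
    resSubgroup_decomp_eq_zero_of_localization_eq_zero (isOpen_stabilizer_geomPrimaryTorsion V p) w G h0
  rw [resOfLe_inf_resH1Hom_subgroupIncl_eq_zero_iff, resSubgroup_resH1Hom_proj, hres, map_zero]

omit [NumberField K] [V.IsElliptic] in
/-- **`H¹(ι)` commutes with restriction to `D_w`**: `res_{D_w}(H¹(ι) g) = H¹(ι|_{D_w})(res_{D_w} g)`. [cite: SerreGaloisCohomology1997, I §2.4] -/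
theorem resSubgroup_resH1Hom_subtype (D : Subgroup (absoluteGaloisGroup K))
    (g : discreteH1 (absoluteGaloisGroup K) ↥(V.endEigenPrimaryTorsion p π r)) :
    ResKernel.resSubgroup D (V.geomPrimaryTorsion p)
        (resH1Hom (ContinuousMonoidHom.id (absoluteGaloisGroup K)) (V.endEigenPrimaryTorsion p π r).subtype (fun _ _ ↦ rfl) g) =
      resH1Hom (ContinuousMonoidHom.id D) (V.endEigenPrimaryTorsion p π r).subtype (fun _ _ ↦ rfl)
        (ResKernel.resSubgroup D ↥(V.endEigenPrimaryTorsion p π r) g) := by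
  have hnat := congrArg (fun f ↦ f g) (ResKernel.resH1Hom_comp_resSubgroup (ContinuousMonoidHom.id (absoluteGaloisGroup K))
    (V.endEigenPrimaryTorsion p π r).subtype (fun _ _ ↦ rfl) D D (ContinuousMonoidHom.id _) (fun _ ↦ rfl) (fun _ _ ↦ rfl))
  simp only [AddMonoidHom.comp_apply] at hnat
  exact hnat.symm

omit [NumberField K] [V.IsElliptic] in
/-- **`H¹(e) ∘ H¹(ι) = id` on `H¹(Γ_K, W*)`** (`e ∘ ι = id`). [cite: SerreGaloisCohomology1997, I §2.4] -/
theorem resH1Hom_proj_resH1Hom_subtype (he₁ : ∀ x : ↥(V.endEigenPrimaryTorsion p π r), e x = x)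
    (g : discreteH1 (absoluteGaloisGroup K) ↥(V.endEigenPrimaryTorsion p π r)) :
    resH1Hom (ContinuousMonoidHom.id (absoluteGaloisGroup K)) e (fun σ m ↦ he σ m)
        (resH1Hom (ContinuousMonoidHom.id (absoluteGaloisGroup K)) (V.endEigenPrimaryTorsion p π r).subtype (fun _ _ ↦ rfl) g) = g := by
  rw [resH1Hom_resH1Hom]
  have hφ : (ContinuousMonoidHom.id (absoluteGaloisGroup K)).comp (ContinuousMonoidHom.id (absoluteGaloisGroup K)) =
      ContinuousMonoidHom.id _ := ContinuousMonoidHom.ext fun _ ↦ rfl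
  have hψ : e.comp (V.endEigenPrimaryTorsion p π r).subtype = AddMonoidHom.id _ := AddMonoidHom.ext fun t ↦ he₁ t
  rw [resH1Hom_congr hφ hψ _ (fun _ _ ↦ rfl), resH1Hom_id, AddMonoidHom.id_apply]

omit [NumberField K] [V.IsElliptic] [Fact (Nat.Prime p)] in
/-- **Level-`N` shadow, local form**: over any `K`-field `E`, `H¹(ι_N)(H¹(eN) a) = H¹(j)(H¹(ι_N) a)` for an intertwining endomorphism `j` of
`E[p^∞]` with `j ∘ ι_N = ι_N ∘ eN` (on cocycles). [cite: SerreGaloisCohomology1997, I §2.4] -/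
theorem map_primaryInclusion_map_restrictField_eq (E : Type) [Field E] [Algebra K E]
    (eN : (V.torsionGaloisModule ((p ^ N : ℕ) : ℤ)).toContRepresentation →ⁱL (V.torsionGaloisModule ((p ^ N : ℕ) : ℤ)).toContRepresentation)
    (j : (primaryGaloisModule V p).toContRepresentation →ⁱL (primaryGaloisModule V p).toContRepresentation)
    (hj : ∀ y, j (primaryInclusion V p N y) = primaryInclusion V p N (eN y))
    (a : galoisCohomology (GaloisRep.restrictField E (V.torsionGaloisModule ((p ^ N : ℕ) : ℤ))) 1) :
    galoisCohomology.map ((primaryInclusion V p N).restrictField E) 1 (galoisCohomology.map (eN.restrictField E) 1 a) =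
      galoisCohomology.map (j.restrictField E) 1 (galoisCohomology.map ((primaryInclusion V p N).restrictField E) 1 a) := by
  obtain ⟨φ, rfl⟩ := oneCocycleClass_surjective _ a
  rw [galoisCohomology.map_one_oneCocycleClass, galoisCohomology.map_one_oneCocycleClass, galoisCohomology.map_one_oneCocycleClass,
    galoisCohomology.map_one_oneCocycleClass]
  congr 1
  refine Subtype.ext (ContinuousMap.ext fun σ ↦ ?_)
  exact (hj (φ.1 σ)).symm

omit [V.IsElliptic] in
/-- **Local vanishing of the level lift ⟺ the e-relaxed propagated zero condition**: `res_{D_w}(Φ x) = 0 ↔ H¹(ι_N)(H¹(eN)(loc_w x)) = 0`,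
i.e. `loc_w x ∈ L_w = H¹(eN)⁻¹ ker(H¹(K_w, E[p^N]) → H¹(K_w, E[p^∞]))` (both say `e_*(res_{D_w} H¹(ι_N) x) = 0`: transport `⊤ ⊓ D_w = D_w`, resp.
`inflDecomp` injective, `H¹(j) ∘ infl = infl ∘ j_*` (p673077), `ι_*` injective on `H¹(D_w, ·)` (p668513)). [cite: GreenbergLNM1716, §5 proof of Prop. 5.8]
[cite: SerreGaloisCohomology1997, I §2.4] -/
theorem resOfLe_levelLift_eq_zero_iff (he₁ : ∀ x : ↥(V.endEigenPrimaryTorsion p π r), e x = x)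
    (eN : (V.torsionGaloisModule ((p ^ N : ℕ) : ℤ)).toContRepresentation →ⁱL (V.torsionGaloisModule ((p ^ N : ℕ) : ℤ)).toContRepresentation)
    (heN : ∀ y, primaryInclusion V p N (eN y) = (e (primaryInclusion V p N y) : V.geomPrimaryTorsion p))
    (w : HeightOneSpectrum (𝓞 K)) (x : galoisCohomology (V.torsionGaloisModule ((p ^ N : ℕ) : ℤ)) 1) :
    resOfLe ↥(V.endEigenPrimaryTorsion p π r) (inf_le_left : (⊤ : Subgroup (absoluteGaloisGroup K)) ⊓ decomp w ≤ ⊤)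
        (resH1Hom (Literature.NumberTheory.EllipticCurves.subgroupIncl (⊤ : Subgroup (absoluteGaloisGroup K)))
          (AddMonoidHom.id ↥(V.endEigenPrimaryTorsion p π r)) (fun _ _ ↦ rfl)
          (resH1Hom (ContinuousMonoidHom.id (absoluteGaloisGroup K)) e (fun σ m ↦ he σ m)
            (toDiscreteH1 (isOpen_stabilizer_geomPrimaryTorsion V p) (galoisCohomology.map (primaryInclusion V p N) 1 x)))) = 0 ↔
      galoisCohomology.map ((primaryInclusion V p N).restrictField (w.adicCompletion K)) 1
        (galoisCohomology.map (eN.restrictField (w.adicCompletion K)) 1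
          (galoisCohomology.localization (V.torsionGaloisModule ((p ^ N : ℕ) : ℤ)) (Sum.inr w : Place K) 1 x)) = 0 := by
  have hM : ∀ m : V.geomPrimaryTorsion p, IsOpen {σ : absoluteGaloisGroup K | σ • m = m} := isOpen_stabilizer_geomPrimaryTorsion V p
  -- the endomorphism `j = ι ∘ e` of `E[p^∞]`
  have hjf : ∀ (σ : absoluteGaloisGroup K) (y : V.geomPrimaryTorsion p),
      (((V.endEigenPrimaryTorsion p π r).subtype.comp e) (σ • y)) = σ • ((V.endEigenPrimaryTorsion p π r).subtype.comp e) y :=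
    fun σ y ↦ by
      simp only [AddMonoidHom.comp_apply, AddSubgroup.coe_subtype, he, WeierstrassCurve.endEigenPrimaryTorsion.coe_smul]
  obtain ⟨j, hj⟩ := exists_primaryEndo V p ((V.endEigenPrimaryTorsion p π r).subtype.comp e) hjf
  have hjι : ∀ y, j (primaryInclusion V p N y) = primaryInclusion V p N (eN y) := fun y ↦ by
    rw [hj, heN, AddMonoidHom.comp_apply, AddSubgroup.coe_subtype]
  set G := galoisCohomology.map (primaryInclusion V p N) 1 x with hG
  set yv := ResKernel.resSubgroup (decomp (K := K) w) (V.geomPrimaryTorsion p) (toDiscreteH1 hM G) with hyv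
  -- the right-hand side is `inflDecomp (ι_w (e_w yv))`
  have h1 : galoisCohomology.map ((primaryInclusion V p N).restrictField (w.adicCompletion K)) 1
        (galoisCohomology.localization (V.torsionGaloisModule ((p ^ N : ℕ) : ℤ)) (Sum.inr w : Place K) 1 x) =
      galoisCohomology.localization (primaryGaloisModule V p) (Sum.inr w : Place K) 1 G :=
    (localization_map_one (primaryInclusion V p N) (Sum.inr w : Place K) x).symm
  have h2 : galoisCohomology.localization (primaryGaloisModule V p) (Sum.inr w : Place K) 1 G = inflDecomp hM w yv :=
    (inflDecomp_resSubgroup hM w G).symm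
  have hR : galoisCohomology.map ((primaryInclusion V p N).restrictField (w.adicCompletion K)) 1
        (galoisCohomology.map (eN.restrictField (w.adicCompletion K)) 1
          (galoisCohomology.localization (V.torsionGaloisModule ((p ^ N : ℕ) : ℤ)) (Sum.inr w : Place K) 1 x)) =
      inflDecomp hM w (resH1Hom (ContinuousMonoidHom.id (decomp (K := K) w)) ((V.endEigenPrimaryTorsion p π r).subtype.comp e)
        (fun σ m ↦ hjf σ m) yv) := by
    rw [map_primaryInclusion_map_restrictField_eq V p N (w.adicCompletion K) eN j hjι, h1, h2]
    exact map_restrictField_inflDecomp hM w ((V.endEigenPrimaryTorsion p π r).subtype.comp e) hjf j hj yv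
  -- `(ι ∘ e)_* = ι_* ∘ e_*` on `H¹(D_w, ·)`
  have hsplit : resH1Hom (ContinuousMonoidHom.id (decomp (K := K) w)) ((V.endEigenPrimaryTorsion p π r).subtype.comp e)
        (fun σ m ↦ hjf σ m) yv =
      resH1Hom (ContinuousMonoidHom.id (decomp (K := K) w)) (V.endEigenPrimaryTorsion p π r).subtype (fun _ _ ↦ rfl)
        (resH1Hom (ContinuousMonoidHom.id (decomp (K := K) w)) e (fun σ m ↦ he σ m) yv) := by
    rw [resH1Hom_resH1Hom]
    exact DFunLike.congr_fun (resH1Hom_congr (ContinuousMonoidHom.ext fun _ ↦ rfl) rfl _ _) yv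
  rw [resOfLe_inf_resH1Hom_subgroupIncl_eq_zero_iff, resSubgroup_resH1Hom_proj, hR, hsplit]
  constructor
  · intro h0
    rw [h0, map_zero, map_zero]
    rfl
  · intro h0
    apply resH1Hom_subtype_injective V p π r (decomp (K := K) w) e he₁ he
    apply inflDecomp_injective hM w
    rw [map_zero, map_zero]
    exact h0

omit [V.IsElliptic] in
/-- **`Φ(H¹_𝓖) ≤ 𝔖_v̄(K, W*)`** (`K` totally complex, `p ∈ v`, `v̄ ≠ v`, `𝓖 = 𝓕[v ↦ ⊤]` with the propagated zero condition off `v`): `Φ x` dies on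
`D_w` for `w ∤ p`, at the (complex) infinite places, and on `D_v̄`. [cite: Agboola2007, §3 (arXiv p0008:L58–64), §6] [cite: GreenbergLNM1716, §5] -/
theorem levelLift_mem_restrictedSelmerBase [IsTotallyComplex K] {v vbar : HeightOneSpectrum (𝓞 K)}
    (hv : ((p : ℕ) : 𝓞 K) ∈ v.asIdeal) (hne : vbar ≠ v)
    (𝓕 : SelmerStructure (V.torsionGaloisModule ((p ^ N : ℕ) : ℤ)))
    (h𝓕 : ∀ w : HeightOneSpectrum (𝓞 K), w ≠ v →
      𝓕 (Sum.inr w) = (galoisCohomology.map ((primaryInclusion V p N).restrictField (w.adicCompletion K)) 1).ker)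
    {x : galoisCohomology (V.torsionGaloisModule ((p ^ N : ℕ) : ℤ)) 1}
    (hx : x ∈ SelmerStructure.selmerGroup (Function.update 𝓕 (Sum.inr v : Place K) ⊤)) :
    resH1Hom (Literature.NumberTheory.EllipticCurves.subgroupIncl (⊤ : Subgroup (absoluteGaloisGroup K)))
        (AddMonoidHom.id ↥(V.endEigenPrimaryTorsion p π r)) (fun _ _ ↦ rfl)
        (resH1Hom (ContinuousMonoidHom.id (absoluteGaloisGroup K)) e (fun σ m ↦ he σ m)
          (toDiscreteH1 (isOpen_stabilizer_geomPrimaryTorsion V p) (galoisCohomology.map (primaryInclusion V p N) 1 x))) ∈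
      restrictedSelmerBase ↥(V.endEigenPrimaryTorsion p π r) p vbar := by
  rw [SelmerStructure.mem_selmerGroup_iff] at hx
  have hker : ∀ w : HeightOneSpectrum (𝓞 K), w ≠ v →
      galoisCohomology.map ((primaryInclusion V p N).restrictField (w.adicCompletion K)) 1
        (galoisCohomology.localization (V.torsionGaloisModule ((p ^ N : ℕ) : ℤ)) (Sum.inr w : Place K) 1 x) = 0 := by
    intro w hw
    have h := hx (Sum.inr w)
    rw [Function.update_of_ne (fun h' ↦ hw (Sum.inr_injective h')), h𝓕 w hw] at h
    exact (AddMonoidHom.mem_ker).mp h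
  rw [mem_restrictedSelmerBase_iff_resOfLe]
  refine ⟨fun w hpw ↦ ?_, fun w ↦ resOfLe_decompInf_eq_zero_of_isComplex _ (IsTotallyComplex.isComplex w) _, ?_⟩
  · have hwv : w ≠ v := fun h ↦ hpw (h ▸ hv)
    exact resOfLe_levelLift_eq_zero_of_map_eq_zero V p π r N e he w x (hker w hwv)
  · exact resOfLe_levelLift_eq_zero_of_map_eq_zero V p π r N e he vbar x (hker vbar hne)

/-- **Every `y ∈ 𝔖_v̄(K, W*)` killed by `p^N` is a level lift `Φ x`, `x ∈ H¹_𝓖`** (`𝓖 = 𝓕[v ↦ ⊤]`, `⊤` at infinity; places above `p` = `v, v̄`):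
`ι_* y` is `p^N`-torsion hence `H¹(ι_N) x` (image = `p^N`-torsion, divisibility of `E(K̄)`), `loc_w H¹(ι_N) x = 0` off `v`, `Φ x = e_* ι_* y = y`.
[cite: GreenbergLNM1716, §5 proof of Prop. 5.8] [cite: JetchevSkinnerWan2017, §3.3 (arXiv:1512.06894 p. 11)] -/
theorem exists_levelLift_eq_of_mem_restrictedSelmerBase (he₁ : ∀ x : ↥(V.endEigenPrimaryTorsion p π r), e x = x)
    {v vbar : HeightOneSpectrum (𝓞 K)}
    (hall : ∀ w : HeightOneSpectrum (𝓞 K), ((p : ℕ) : 𝓞 K) ∈ w.asIdeal → w = v ∨ w = vbar)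
    (𝓕 : SelmerStructure (V.torsionGaloisModule ((p ^ N : ℕ) : ℤ)))
    (h𝓕inf : ∀ w : InfinitePlace K, 𝓕 (Sum.inl w) = ⊤)
    (h𝓕 : ∀ w : HeightOneSpectrum (𝓞 K), w ≠ v →
      𝓕 (Sum.inr w) = (galoisCohomology.map ((primaryInclusion V p N).restrictField (w.adicCompletion K)) 1).ker)
    {y : subgroupH1 (⊤ : Subgroup (absoluteGaloisGroup K)) ↥(V.endEigenPrimaryTorsion p π r)}
    (hy : y ∈ restrictedSelmerBase ↥(V.endEigenPrimaryTorsion p π r) p vbar) (hNy : p ^ N • y = 0) :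
    ∃ x ∈ SelmerStructure.selmerGroup (Function.update 𝓕 (Sum.inr v : Place K) ⊤),
      resH1Hom (Literature.NumberTheory.EllipticCurves.subgroupIncl (⊤ : Subgroup (absoluteGaloisGroup K)))
          (AddMonoidHom.id ↥(V.endEigenPrimaryTorsion p π r)) (fun _ _ ↦ rfl)
          (resH1Hom (ContinuousMonoidHom.id (absoluteGaloisGroup K)) e (fun σ m ↦ he σ m)
            (toDiscreteH1 (isOpen_stabilizer_geomPrimaryTorsion V p) (galoisCohomology.map (primaryInclusion V p N) 1 x))) = y := by
  have hM : ∀ m : V.geomPrimaryTorsion p, IsOpen {σ : absoluteGaloisGroup K | σ • m = m} := isOpen_stabilizer_geomPrimaryTorsion V p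
  have hbij := bijective_resH1Hom_subgroupIncl ↥(V.endEigenPrimaryTorsion p π r) (⊤ : Subgroup (absoluteGaloisGroup K)) Subgroup.mem_top
  obtain ⟨y', rfl⟩ := hbij.surjective y
  -- `z = ι_* y'` as a class of `H¹(K, E[p^∞])`
  set z : discreteH1 (absoluteGaloisGroup K) (V.geomPrimaryTorsion p) :=
    resH1Hom (ContinuousMonoidHom.id (absoluteGaloisGroup K)) (V.endEigenPrimaryTorsion p π r).subtype (fun _ _ ↦ rfl) y' with hz
  have hy'0 : p ^ N • y' = 0 := by
    apply hbij.injective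
    rw [map_nsmul, hNy, map_zero]
  have hz0 : p ^ N • z = 0 := by
    rw [hz, ← map_nsmul, hy'0, map_zero]
  let G : galoisCohomology (primaryGaloisModule V p) 1 := z
  have hGz : toDiscreteH1 hM G = z := rfl
  have hG0 : p ^ N • G = 0 := hz0
  obtain ⟨x, hx⟩ := (mem_range_map_primaryInclusion_iff V p N V.zsmul_geomPoints_surjective_holds G).mpr hG0
  refine ⟨x, ?_, ?_⟩
  · rw [SelmerStructure.mem_selmerGroup_iff]
    rintro (w | w)
    · rw [Function.update_of_ne Sum.inl_ne_inr, h𝓕inf]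
      exact AddSubgroup.mem_top _
    · by_cases hw : w = v
      · subst hw
        rw [Function.update_self]
        exact AddSubgroup.mem_top _
      · rw [Function.update_of_ne (fun h ↦ hw (Sum.inr_injective h)), h𝓕 w hw]
        refine (AddMonoidHom.mem_ker).mpr ?_
        have h1 : galoisCohomology.map ((primaryInclusion V p N).restrictField (w.adicCompletion K)) 1
              (galoisCohomology.localization (V.torsionGaloisModule ((p ^ N : ℕ) : ℤ)) (Sum.inr w : Place K) 1 x) =
            galoisCohomology.localization (primaryGaloisModule V p) (Sum.inr w : Place K) 1 (galoisCohomology.map (primaryInclusion V p N) 1 x) :=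
          (localization_map_one (primaryInclusion V p N) (Sum.inr w : Place K) x).symm
        refine h1.trans ?_
        rw [hx]
        refine (localization_inr_eq_zero_iff hM w G).mpr ?_
        rw [hGz, hz, resSubgroup_resH1Hom_subtype]
        -- `res_{D_w} y' = 0` from `y ∈ 𝔖_v̄(K, W*)` (`w ∤ p` or `w = v̄`)
        have hyw : resOfLe ↥(V.endEigenPrimaryTorsion p π r) (inf_le_left : (⊤ : Subgroup (absoluteGaloisGroup K)) ⊓ decomp w ≤ ⊤)
            (resH1Hom (Literature.NumberTheory.EllipticCurves.subgroupIncl (⊤ : Subgroup (absoluteGaloisGroup K)))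
              (AddMonoidHom.id ↥(V.endEigenPrimaryTorsion p π r)) (fun _ _ ↦ rfl) y') = 0 := by
          rw [mem_restrictedSelmerBase_iff_resOfLe] at hy
          by_cases hpw : ((p : ℕ) : 𝓞 K) ∈ w.asIdeal
          · rcases hall w hpw with h | h
            · exact absurd h hw
            · subst h
              exact hy.2.2
          · exact hy.1 w hpw
        rw [resOfLe_inf_resH1Hom_subgroupIncl_eq_zero_iff] at hyw
        rw [hyw, map_zero]
  · rw [hx, hGz, hz, resH1Hom_proj_resH1Hom_subtype V p π r e he he₁]

include he in
/-- **(P1)-LIFT — `[H¹_𝓖(K, E[p^N]) : H¹_𝓕(K, E[p^N])] = #loc_v(𝔖_v̄(K, W*))`.** `K` totally complex with places above `p` exactly `v ≠ v̄`;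
OPTION A‴ structures: `𝓕_w = ker(H¹(K_w, E[p^N]) → H¹(K_w, E[p^∞]))` at finite `w ≠ v`, `⊤` at infinity, `𝓕_v = L_v = H¹(eN)⁻¹(that kernel)`,
`𝓖 = 𝓕[v ↦ ⊤]`; any `N` with `p^N · 𝔖_v̄(K, W*) = 0`. First isomorphism theorem for `res_{D_v} ∘ Φ` on `H¹_𝓖` (kernel `H¹_𝓕`, image
`res_{D_v}(𝔖_v̄)`); left side counted by p675947 `relIndex_selmerGroup_update_top_mul_eq_sq`, right side by p674907
`card_restrictedSelmerBase_eq_card_inf_mul_card_range_resOfLe`. [cite: GreenbergLNM1716, §5 proof of Prop. 5.8] [cite: MazurRubin2004, Def. 2.1.1]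
[cite: Agboola2007, §3, §6] -/
theorem relIndex_selmerGroup_update_top_eq_natCard_range_resOfLe [IsTotallyComplex K]
    (he₁ : ∀ x : ↥(V.endEigenPrimaryTorsion p π r), e x = x)
    (eN : (V.torsionGaloisModule ((p ^ N : ℕ) : ℤ)).toContRepresentation →ⁱL (V.torsionGaloisModule ((p ^ N : ℕ) : ℤ)).toContRepresentation)
    (heN : ∀ y, primaryInclusion V p N (eN y) = (e (primaryInclusion V p N y) : V.geomPrimaryTorsion p))
    {v vbar : HeightOneSpectrum (𝓞 K)} (hv : ((p : ℕ) : 𝓞 K) ∈ v.asIdeal) (hne : vbar ≠ v)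
    (hall : ∀ w : HeightOneSpectrum (𝓞 K), ((p : ℕ) : 𝓞 K) ∈ w.asIdeal → w = v ∨ w = vbar)
    (hN : ∀ y ∈ restrictedSelmerBase ↥(V.endEigenPrimaryTorsion p π r) p vbar, p ^ N • y = 0)
    (𝓕 : SelmerStructure (V.torsionGaloisModule ((p ^ N : ℕ) : ℤ)))
    (h𝓕inf : ∀ w : InfinitePlace K, 𝓕 (Sum.inl w) = ⊤)
    (h𝓕 : ∀ w : HeightOneSpectrum (𝓞 K), w ≠ v →
      𝓕 (Sum.inr w) = (galoisCohomology.map ((primaryInclusion V p N).restrictField (w.adicCompletion K)) 1).ker)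
    (h𝓕v : 𝓕 (Sum.inr v) = ((galoisCohomology.map ((primaryInclusion V p N).restrictField (v.adicCompletion K)) 1).ker).comap
      (galoisCohomology.map (eN.restrictField (v.adicCompletion K)) 1)) :
    𝓕.selmerGroup.relIndex (SelmerStructure.selmerGroup (Function.update 𝓕 (Sum.inr v : Place K) ⊤)) =
      Nat.card ((resOfLe ↥(V.endEigenPrimaryTorsion p π r) (inf_le_left : (⊤ : Subgroup (absoluteGaloisGroup K)) ⊓ decomp v ≤ ⊤)).comp
        (restrictedSelmerBase ↥(V.endEigenPrimaryTorsion p π r) p vbar).subtype).range := by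
  have hM : ∀ m : V.geomPrimaryTorsion p, IsOpen {σ : absoluteGaloisGroup K | σ • m = m} := isOpen_stabilizer_geomPrimaryTorsion V p
  set Gsel := SelmerStructure.selmerGroup (Function.update 𝓕 (Sum.inr v : Place K) ⊤) with hGsel
  -- the level-lift map as a homomorphism
  set Φ : galoisCohomology (V.torsionGaloisModule ((p ^ N : ℕ) : ℤ)) 1 →+
      subgroupH1 (⊤ : Subgroup (absoluteGaloisGroup K)) ↥(V.endEigenPrimaryTorsion p π r) :=
    ((resH1Hom (Literature.NumberTheory.EllipticCurves.subgroupIncl (⊤ : Subgroup (absoluteGaloisGroup K)))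
        (AddMonoidHom.id ↥(V.endEigenPrimaryTorsion p π r)) (fun _ _ ↦ rfl)).comp
      (resH1Hom (ContinuousMonoidHom.id (absoluteGaloisGroup K)) e (fun σ m ↦ he σ m))).comp
      ((toDiscreteH1 hM).toAddMonoidHom.comp (galoisCohomology.map (primaryInclusion V p N) 1)) with hΦdef
  have hΦ : ∀ x, Φ x = resH1Hom (Literature.NumberTheory.EllipticCurves.subgroupIncl (⊤ : Subgroup (absoluteGaloisGroup K)))
      (AddMonoidHom.id ↥(V.endEigenPrimaryTorsion p π r)) (fun _ _ ↦ rfl)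
      (resH1Hom (ContinuousMonoidHom.id (absoluteGaloisGroup K)) e (fun σ m ↦ he σ m)
        (toDiscreteH1 hM (galoisCohomology.map (primaryInclusion V p N) 1 x))) := fun _ ↦ rfl
  set ψ : Gsel →+ subgroupH1 ((⊤ : Subgroup (absoluteGaloisGroup K)) ⊓ decomp v) ↥(V.endEigenPrimaryTorsion p π r) :=
    (resOfLe ↥(V.endEigenPrimaryTorsion p π r) (inf_le_left : (⊤ : Subgroup (absoluteGaloisGroup K)) ⊓ decomp v ≤ ⊤)).comp
      (Φ.comp Gsel.subtype) with hψdef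
  have hψ : ∀ x : Gsel, ψ x = resOfLe ↥(V.endEigenPrimaryTorsion p π r)
      (inf_le_left : (⊤ : Subgroup (absoluteGaloisGroup K)) ⊓ decomp v ≤ ⊤) (Φ (x : galoisCohomology _ 1)) := fun _ ↦ rfl
  -- kernel = `H¹_𝓕`
  have hker : ψ.ker = (𝓕.selmerGroup).addSubgroupOf Gsel := by
    ext ⟨x, hx⟩
    rw [AddMonoidHom.mem_ker, AddSubgroup.mem_addSubgroupOf, hψ, hΦ, AddSubgroup.coe_mk,
      resOfLe_levelLift_eq_zero_iff V p π r N e he he₁ eN heN v x, SelmerStructure.mem_selmerGroup_iff]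
    have hx' := (SelmerStructure.mem_selmerGroup_iff _ x).mp hx
    constructor
    · rintro h0 (w | w)
      · rw [h𝓕inf]
        exact AddSubgroup.mem_top _
      · by_cases hw : w = v
        · subst hw
          rw [h𝓕v]
          exact AddSubgroup.mem_comap.mpr (AddMonoidHom.mem_ker.mpr h0)
        · have h := hx' (Sum.inr w)
          rwa [Function.update_of_ne (fun h' ↦ hw (Sum.inr_injective h'))] at h
    · intro hF
      have h := hF (Sum.inr v)
      rw [h𝓕v] at h
      exact AddMonoidHom.mem_ker.mp (AddSubgroup.mem_comap.mp h)
  -- image = `res_{D_v}(𝔖_v̄(K, W*))`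
  have hrange : ψ.range = ((resOfLe ↥(V.endEigenPrimaryTorsion p π r)
      (inf_le_left : (⊤ : Subgroup (absoluteGaloisGroup K)) ⊓ decomp v ≤ ⊤)).comp
        (restrictedSelmerBase ↥(V.endEigenPrimaryTorsion p π r) p vbar).subtype).range := by
    ext t
    constructor
    · rintro ⟨⟨x, hx⟩, rfl⟩
      exact ⟨⟨Φ x, (hΦ x).symm ▸ levelLift_mem_restrictedSelmerBase V p π r N e he hv hne 𝓕 h𝓕 hx⟩, rfl⟩
    · rintro ⟨⟨y, hy⟩, rfl⟩
      obtain ⟨x, hx, hxy⟩ := exists_levelLift_eq_of_mem_restrictedSelmerBase V p π r N e he he₁ hall 𝓕 h𝓕inf h𝓕 hy (hN y hy)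
      refine ⟨⟨x, hx⟩, ?_⟩
      rw [hψ, hΦ, AddSubgroup.coe_mk, hxy]
      rfl
  calc 𝓕.selmerGroup.relIndex Gsel = ((𝓕.selmerGroup).addSubgroupOf Gsel).index := rfl
    _ = ψ.ker.index := by rw [hker]
    _ = Nat.card ψ.range := AddSubgroup.index_ker ψ
    _ = _ := by rw [hrange]

end LevelLift

end Summit.BirchSwinnertonDyer.BirchSwinnertonDyer.Theorems.PrintCf2.RestrictedSelmerPair

end
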